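/-
Copyright (c) 2026 the pub-hodgecm-mathlib formalisation cell (harness21).  Prover seat hodgecm-mathlib-K2Liu-p25 (g2), Track B «K2-LIT» ∕ hLiu418
#184♮ = `stmt-HodgeConjecture-24832`, socket #41 — ORGAN (T) «RIGHT TRANSLATION» (LEAD F0P6-plan (g14) BATCH #66 (1) ∕ RULING «M-158j» road (R-c) 2026-09-04T22:16:18Z:
carry #41 from Levi-adapted Iwasawa data to conjugate data).  THEOREMS ONLY (no `def`, no instance, no notation, no `sorry`).
-/
import Summits.HodgeConjecture.HodgeConjecture.Theorems.K2LiuRankOneCentreContinuation     -- ★ `differentiable_siegelDeltaCharacter` (+ ★ `K2Lit.SiegelEisensteinSeriesDoubled`)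
import Literature.NumberTheory.K2Lit.SiegelStandardSections                                 -- ★ `IwasawaDatum`, `rightTranslateSpan`, `IsKFinite`, `IsStandardSectionFamily`
import Literature.NumberTheory.Automorphic.AdelicHeightGLProofs                              -- ★ `adelicHeightGL_mul_le_const`, `adelicHeightGL_pos_holds`, `adelicHeightGL_inv`
import HarnessLib

/-!
# Crux `HLiu418`, socket #41, ORGAN (T) «RIGHT TRANSLATION»: the doubled Siegel Eisenstein series under `h ↦ h·x`, conjugate Iwasawa data, the NORMALISED
# translate of a standard family along `p ∈ P_Δ(𝔸)`, and the transport of socket #41's five clauses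

Cell `hodgecm-mathlib`, crux item hLiu418 = `stmt-HodgeConjecture-24832`; squad K2 ∕ K2Liu (L1, LEAD F0P6-plan (g14)); prover K2Liu-p25 (g2).  THEOREMS ONLY; lane
`--supports stmt-HodgeConjecture-24832 --as helper`.

WHY (RULING «M-158j»).  The (u-0c) ∕ I-lineage of the #41 middle term needs the Levi letter `hΛK : Λ(K_{GL₂}) ⊆ 𝒦.K`, which holds for LEVI-ADAPTED Iwasawa data only, while
socket #41 quantifies over every STANDARD datum `𝒦` (★ `IwasawaDatum.IsStd`).  Road (R-c) = prove #41 for adapted data and TRANSPORT.  At the archimedean place every standard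
datum is a `P_Δ(L ⊗ ℝ)`-conjugate of an adapted one (`H_∞ = P_∞ · C_∞` and the majorant stabilisers are `H_∞`-conjugate — the (T3) row, a separate file); this file is the
transport itself, for conjugation by ANY `p ∈ P_Δ(𝔸)`:
* §1 (T1) `eisensteinSeriesDelta_comp_mul_right` — `E(h ↦ f(h·x))(g) = E(f)(g·x)` for every `x ∈ H(𝔸)` (coset-sum re-indexing; ★ `eisensteinSeriesDelta` is the `tsum` over
  `P_Δ(L⁺)\H(L⁺)` read at `q.out · h`); `eisensteinSeriesDelta_const_mul`; `eisensteinFamilyDelta_normalisedTranslate`.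
* §2 (T2, datum) `exists_iwasawaDatum_conj` — for every `x ∈ H(𝔸)` the conjugate `{k | x⁻¹ k x ∈ 𝒦.K}` is again an Iwasawa datum (compact: a homeomorphic image; Iwasawa:
  `x = p₁k₁` and `H = P_Δ · p₁ K p₁⁻¹`).  (The transport of ★ `IsStd` — (P0)(P1)(P2) with the frame `S ↦ x_∞ S` — is the companion file's.)
* §3 (T2, family) THE HONEST FAMILY TRANSPORT.  `h ↦ f_s(h·x)` is NOT flat for the conjugate datum in general (`f_s(k·p) = f_s(p·k′) = χ_s(p)·f_{s₀}(k′)` depends on `s`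
  unless `|det_Δ p| = 1`); the NORMALISED translate along `p ∈ P_Δ(𝔸)`, `(f′)^♮_s := χ_s(p)⁻¹ · f′_s(· · p)` (`χ_s(p) = siegelDeltaCharacter χ s p`, entire and zero-free in `s`),
  IS standard for `𝒦` whenever `f′` is standard for `𝒦′` and `p⁻¹ 𝒦.K p ⊆ 𝒦′.K`: **`isStandardSectionFamily_normalisedTranslate`** (section law ★ `IsSiegelDeltaSection.rightTranslate`;
  holomorphy ★ `differentiable_siegelDeltaCharacter`; `K`-finiteness: the right `𝒦.K`-translates are the image of the right `𝒦′.K`-translates under `φ ↦ χ_s(p)⁻¹·φ(· · p)`;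
  flatness: `(f′)^♮_s(k) = f′_s(p⁻¹kp)`), and `continuous_normalisedTranslate`.
* §4 (T4) **`continuation_transport`** — socket #41's conclusion `∃ P Es, (A1) ∧ (A2) ∧ (A3) ∧ (A4) ∧ (A5)` for `f′` FROM the same five clauses for `(f′)^♮` (the adapted side):
  `Es′(s, h) := χ_s(p) · Es(s, h·p⁻¹)`; (A4) by §1; (A5) by the two-sided height comparison `‖h·y‖^A ≤ c_{y,A} · ‖h‖^A` for EVERY real `A`
  (§0 `exists_rpow_adelicHeightGL_mul_right_le`: ★ `adelicHeightGL_mul_le_const`, ★ `adelicHeightGL_pos_holds`, ★ `adelicHeightGL_inv`) and a local bound of `|χ_s(p)|`.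
CONSUMER RECIPE (#41 at an arbitrary standard `𝒦′` from #41 at an adapted `𝒦 = p 𝒦′ p⁻¹`): `have h := ‹#41 adapted› … 𝒦 (f′)^♮ (isStandardSectionFamily_normalisedTranslate …)
(continuous_normalisedTranslate …); obtain ⟨P, Es, hA1, …, hA5⟩ := h; exact continuation_transport … hn p f′ P Es hA1 hA2 hA3 hA4 hA5`.
BY VALUE elsewhere (named): (T3)-arch «every standard `C_∞` is a `P_Δ(L⊗ℝ)`-conjugate of a Levi-compatible one» (majorant transitivity); the finite-place part of `hΛK` is NOT
a transport matter (open Iwasawa subgroups need not be conjugate to Levi-adapted ones) — road (R-a) there.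
References: [MoeglinWaldspurger1995, I.2.2, II.1.5–II.1.7, IV.1.8]; [BorelJacquet1979, §1.2, §4.1]; [Tan1999, §1]; [KudlaRallis1994, §1]; [Liu2021, Lem. B.10 p. 102].
HONEST LABEL.  Count-neutral helper: `HC_CM` is proved only modulo the 7 printed citations (2 remaining named inputs: hLiu418 = `stmt-HodgeConjecture-24832`,
h413 = `stmt-HodgeConjecture-24833`) until rung 0 closes; this file closes no socket.
-/

set_option autoImplicit false
set_option linter.dupNamespace false -- the mandated namespace repeats `HodgeConjecture.HodgeConjecture`

noncomputable section

open scoped Matrix Topology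
open NumberField IsDedekindDomain Filter Set Metric
open Literature.NumberTheory.Automorphic Literature.NumberTheory.GaloisRepresentations
open Literature.NumberTheory.GelbartRogawski1991 Literature.NumberTheory.GelbartRogawski1991.GRConstruction
open Literature.NumberTheory.K2Lit.SiegelDoubled

namespace Summit.HodgeConjecture.HodgeConjecture.Cruxes.HLiu418.K2LiuSiegelEisensteinRightTranslation

open Summit.HodgeConjecture.HodgeConjecture.Cruxes.HLiu418.K2LiuRankOneCentreContinuation (differentiable_siegelDeltaCharacter)

variable (L : Type) [Field L] [NumberField L] [IsCMField L]
variable {N M n : ℕ} (e : Fin N × Fin M ≃ Fin n)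
  (dV : Fin N → L) (hdV : ∀ i, IsCMField.complexConj L (dV i) = dV i)
  (dW : Fin M → L) (hdW : ∀ i, IsCMField.complexConj L (dW i) = dW i)

/-! ## §0 Heights under right translation; the inducing character is zero-free and locally bounded in `s` -/

omit [IsCMField L] in
/-- **TWO-SIDED HEIGHT COMPARISON UNDER RIGHT TRANSLATION, ANY REAL EXPONENT**: for `y ∈ GL_m(𝔸_L)` (`m ≥ 1`) and `A ∈ ℝ` there is `c > 0` with
`‖h·y‖^A ≤ c·‖h‖^A` for all `h` (`‖h y‖ ≤ m‖h‖‖y‖` for `A ≥ 0`; `‖h‖ ≤ m‖hy‖‖y⁻¹‖` for `A < 0`; ★ `adelicHeightGL_mul_le_const`, ★ `adelicHeightGL_pos_holds`).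
[cite: BorelJacquet1979, §1.2] [cite: MoeglinWaldspurger1995, I.2.2] -/
theorem exists_rpow_adelicHeightGL_mul_right_le {m : ℕ} [NeZero m] (y : GL (Fin m) (AdeleRing (𝓞 L) L)) (A : ℝ) :
    ∃ c : ℝ, 0 < c ∧ ∀ h : GL (Fin m) (AdeleRing (𝓞 L) L), adelicHeightGL m L (h * y) ^ A ≤ c * adelicHeightGL m L h ^ A := by
  have hpos : ∀ g : GL (Fin m) (AdeleRing (𝓞 L) L), 0 < adelicHeightGL m L g := fun g => adelicHeightGL_pos_holds (n := m) (K := L) g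
  have hm : (0 : ℝ) < m := by exact_mod_cast Nat.pos_of_ne_zero (NeZero.ne m)
  by_cases hA : 0 ≤ A
  · refine ⟨((m : ℝ) * adelicHeightGL m L y) ^ A, Real.rpow_pos_of_pos (mul_pos hm (hpos y)) A, fun h => ?_⟩
    have hle : adelicHeightGL m L (h * y) ≤ (m : ℝ) * adelicHeightGL m L y * adelicHeightGL m L h := by
      have := adelicHeightGL_mul_le_const (n := m) (K := L) h y
      linarith [mul_comm (adelicHeightGL m L h) (adelicHeightGL m L y)]
    calc adelicHeightGL m L (h * y) ^ A ≤ ((m : ℝ) * adelicHeightGL m L y * adelicHeightGL m L h) ^ A :=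
          Real.rpow_le_rpow (hpos _).le hle hA
      _ = ((m : ℝ) * adelicHeightGL m L y) ^ A * adelicHeightGL m L h ^ A :=
          Real.mul_rpow (mul_pos hm (hpos y)).le (hpos h).le
  · have hA' : A ≤ 0 := (not_le.1 hA).le
    refine ⟨((m : ℝ) * adelicHeightGL m L y⁻¹) ^ (-A), Real.rpow_pos_of_pos (mul_pos hm (hpos _)) _, fun h => ?_⟩
    -- `‖h‖ ≤ m ‖h y‖ ‖y⁻¹‖`, i.e. `‖h‖ ∕ (m ‖y⁻¹‖) ≤ ‖h y‖`
    have hle : adelicHeightGL m L h ≤ (m : ℝ) * adelicHeightGL m L (h * y) * adelicHeightGL m L y⁻¹ := by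
      have := adelicHeightGL_mul_le_const (n := m) (K := L) (h * y) y⁻¹
      rwa [mul_inv_cancel_right] at this
    have hc : 0 < (m : ℝ) * adelicHeightGL m L y⁻¹ := mul_pos hm (hpos _)
    have hle' : adelicHeightGL m L h / ((m : ℝ) * adelicHeightGL m L y⁻¹) ≤ adelicHeightGL m L (h * y) := by
      rw [div_le_iff₀ hc]
      linarith [mul_comm (adelicHeightGL m L (h * y)) (adelicHeightGL m L y⁻¹)]
    calc adelicHeightGL m L (h * y) ^ A ≤ (adelicHeightGL m L h / ((m : ℝ) * adelicHeightGL m L y⁻¹)) ^ A :=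
          Real.rpow_le_rpow_of_nonpos (div_pos (hpos h) hc) hle' hA'
      _ = ((m : ℝ) * adelicHeightGL m L y⁻¹) ^ (-A) * adelicHeightGL m L h ^ A := by
          rw [Real.div_rpow (hpos h).le hc.le, Real.rpow_neg hc.le, div_eq_mul_inv, mul_comm]

/-- the inducing character `χ_s(p) = χ(det_Δ p)·|det_Δ p|^{s+n∕2}` is never zero (`modDelta p > 0`). [cite: Tan1999, §1] -/
theorem siegelDeltaCharacter_ne_zero (χ : HeckeCharacter L) (s : ℂ) (p : HA L e dV hdV dW hdW) :
    siegelDeltaCharacter L e dV hdV dW hdW χ s p ≠ 0 := by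
  unfold siegelDeltaCharacter
  refine mul_ne_zero (Units.ne_zero _) fun h0 => ?_
  have hb := ((Complex.cpow_eq_zero_iff _ _).1 h0).1
  exact (modDelta_pos L e dV hdV dW hdW p).ne' (by exact_mod_cast hb)

/-- `|χ_s(p)|` is bounded on every ball `dist s z < r` (continuity of the entire `s ↦ χ_s(p)` on the compact closed ball). [cite: Tan1999, §1] -/
theorem exists_bound_siegelDeltaCharacter (χ : HeckeCharacter L) (p : HA L e dV hdV dW hdW) (z : ℂ) (r : ℝ) :
    ∃ B : ℝ, 0 ≤ B ∧ ∀ s : ℂ, dist s z < r → ‖siegelDeltaCharacter L e dV hdV dW hdW χ s p‖ ≤ B := by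
  obtain ⟨B, hB⟩ := (isCompact_closedBall z r).exists_bound_of_continuousOn
    ((differentiable_siegelDeltaCharacter L e dV hdV dW hdW χ p).continuous.continuousOn)
  refine ⟨max B 0, le_max_right _ _, fun s hs => (hB s (mem_closedBall.2 hs.le)).trans (le_max_left _ _)⟩

/-! ## §1 (T1) The Eisenstein series under right translation -/

/-- **(T1) `E(h ↦ f(h·x))(g) = E(f)(g·x)`** for every `x ∈ H(𝔸)`: right translation of the section is right translation of the series (the coset sum
`Σ_{γ ∈ P_Δ(L⁺)\H(L⁺)} f(γ g x)` is read at the same representatives; ★ `eisensteinSeriesDelta`). [cite: MoeglinWaldspurger1995, II.1.5] [cite: Tan1999, §1] -/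
theorem eisensteinSeriesDelta_comp_mul_right (f : HA L e dV hdV dW hdW → ℂ) (x g : HA L e dV hdV dW hdW) :
    eisensteinSeriesDelta L e dV hdV dW hdW (fun h => f (h * x)) g = eisensteinSeriesDelta L e dV hdV dW hdW f (g * x) := by
  simp only [eisensteinSeriesDelta, mul_assoc]

/-- an outer constant passes through the Eisenstein series (`tsum_mul_left`, no convergence needed). [cite: Tan1999, §1] -/
theorem eisensteinSeriesDelta_const_mul (c : ℂ) (f : HA L e dV hdV dW hdW → ℂ) (g : HA L e dV hdV dW hdW) :
    eisensteinSeriesDelta L e dV hdV dW hdW (fun h => c * f h) g = c * eisensteinSeriesDelta L e dV hdV dW hdW f g := by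
  simp only [eisensteinSeriesDelta]
  exact tsum_mul_left

/-- **(T1) for the NORMALISED translate**: `E((f′)^♮_s)(g) = χ_s(p)⁻¹ · E(f′_s)(g·p)` for `(f′)^♮_s = χ_s(p)⁻¹ · f′_s(· · p)` (any scalar family `c`).
[cite: MoeglinWaldspurger1995, II.1.5] [cite: Tan1999, §1] -/
theorem eisensteinFamilyDelta_normalisedTranslate (c : ℂ → ℂ) (f' : ℂ → HA L e dV hdV dW hdW → ℂ) (x : HA L e dV hdV dW hdW) (s : ℂ) (g : HA L e dV hdV dW hdW) :
    eisensteinFamilyDelta L e dV hdV dW hdW (fun s h => (c s)⁻¹ * f' s (h * x)) s g = (c s)⁻¹ * eisensteinFamilyDelta L e dV hdV dW hdW f' s (g * x) := by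
  simp only [eisensteinFamilyDelta]
  rw [eisensteinSeriesDelta_const_mul, eisensteinSeriesDelta_comp_mul_right]

/-! ## §2 (T2, datum) Conjugate Iwasawa data -/

/-- **(T2) CONJUGATE IWASAWA DATA**: for an Iwasawa datum `𝒦` and ANY `x ∈ H(𝔸)`, the conjugate subgroup `{k | x⁻¹ k x ∈ 𝒦.K}` (`= x 𝒦.K x⁻¹`) carries an Iwasawa datum:
it is compact (a homeomorphic image of `𝒦.K`) and `H(𝔸) = P_Δ(𝔸)·(x 𝒦.K x⁻¹)` (write `x = p₁ k₁`, so `x 𝒦.K x⁻¹ = p₁ 𝒦.K p₁⁻¹`, and `h p₁ = p k` gives `h = (p p₁⁻¹)·(p₁ k p₁⁻¹)`).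
[cite: BorelJacquet1979, §4.1] [cite: MoeglinWaldspurger1995, I.2.1] -/
theorem exists_iwasawaDatum_conj (𝒦 : IwasawaDatum L e dV hdV dW hdW) (x : HA L e dV hdV dW hdW) :
    ∃ 𝒦' : IwasawaDatum L e dV hdV dW hdW, ∀ k : HA L e dV hdV dW hdW, k ∈ 𝒦'.K ↔ x⁻¹ * k * x ∈ 𝒦.K := by
  obtain ⟨p₁, k₁, hp₁, hk₁, hx⟩ := 𝒦.iwasawa x
  have hmem : ∀ k : HA L e dV hdV dW hdW, k ∈ 𝒦.K.comap (MulAut.conj x⁻¹).toMonoidHom ↔ x⁻¹ * k * x ∈ 𝒦.K := by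
    intro k
    rw [Subgroup.mem_comap, MulEquiv.coe_toMonoidHom, MulAut.conj_apply, inv_inv]
  refine ⟨⟨𝒦.K.comap (MulAut.conj x⁻¹).toMonoidHom, ?_, ?_⟩, hmem⟩
  · -- compact: the image of `𝒦.K` under `k ↦ x k x⁻¹`
    have hset : ((𝒦.K.comap (MulAut.conj x⁻¹).toMonoidHom : Subgroup (HA L e dV hdV dW hdW)) : Set (HA L e dV hdV dW hdW)) =
        (fun k => x * k * x⁻¹) '' (𝒦.K : Set (HA L e dV hdV dW hdW)) := by
      ext k
      rw [SetLike.mem_coe, hmem, Set.mem_image]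
      constructor
      · intro hk
        exact ⟨x⁻¹ * k * x, hk, by group⟩
      · rintro ⟨k', hk', rfl⟩
        have : x⁻¹ * (x * k' * x⁻¹) * x = k' := by group
        rwa [this]
    rw [hset]
    exact 𝒦.isCompact_K.image ((continuous_const.mul continuous_id).mul continuous_const)
  · -- Iwasawa
    intro h
    obtain ⟨p, k, hp, hk, hh⟩ := 𝒦.iwasawa (h * p₁)
    refine ⟨p * p₁⁻¹, p₁ * k * p₁⁻¹, isSiegelDelta_mul L e dV hdV dW hdW hp (isSiegelDelta_inv L e dV hdV dW hdW hp₁), ?_, ?_⟩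
    · rw [hmem]
      have hk₁' : x⁻¹ * (p₁ * k * p₁⁻¹) * x = k₁⁻¹ * k * k₁ := by rw [hx]; group
      rw [hk₁']
      exact 𝒦.K.mul_mem (𝒦.K.mul_mem (𝒦.K.inv_mem hk₁) hk) hk₁
    · calc h = h * p₁ * p₁⁻¹ := by group
        _ = p * k * p₁⁻¹ := by rw [hh]
        _ = p * p₁⁻¹ * (p₁ * k * p₁⁻¹) := by group

/-! ## §3 (T2, family) The normalised translate of a standard family along `p ∈ P_Δ(𝔸)` -/

section Family

variable {L e dV hdV dW hdW}

/-- the section law of the NORMALISED translate: `(f′)^♮_s = χ_s(p)⁻¹·f′_s(· · p) ∈ I(s, χ)` for `f′_s ∈ I(s, χ)` (★ `IsSiegelDeltaSection.rightTranslate`, `.smul`).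
[cite: Tan1999, §1] -/
theorem isSiegelDeltaSection_normalisedTranslate {χ : HeckeCharacter L} {s : ℂ} {f' : HA L e dV hdV dW hdW → ℂ}
    (hf' : IsSiegelDeltaSection L e dV hdV dW hdW χ s f') (c : ℂ) (p : HA L e dV hdV dW hdW) :
    IsSiegelDeltaSection L e dV hdV dW hdW χ s (fun h => c * f' (h * p)) := by
  intro q hq h
  show c * f' (q * h * p) = siegelDeltaCharacter L e dV hdV dW hdW χ s q * (c * f' (h * p))
  rw [mul_assoc q h p, hf' q hq (h * p)]
  ring

/-- the value of the normalised translate ON `𝒦.K`: `(f′)^♮_s(k) = f′_s(p⁻¹ k p)` (`k p = p·(p⁻¹kp)` and the section law at `p`). [cite: Tan1999, §1] -/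
theorem normalisedTranslate_apply_of_mem {χ : HeckeCharacter L} {s : ℂ} {f' : HA L e dV hdV dW hdW → ℂ}
    (hf' : IsSiegelDeltaSection L e dV hdV dW hdW χ s f') {p : HA L e dV hdV dW hdW} (hp : IsSiegelDelta L e dV hdV dW hdW p) (k : HA L e dV hdV dW hdW) :
    (siegelDeltaCharacter L e dV hdV dW hdW χ s p)⁻¹ * f' (k * p) = f' (p⁻¹ * k * p) := by
  have hkp : k * p = p * (p⁻¹ * k * p) := by group
  rw [hkp, hf' p hp, ← mul_assoc, inv_mul_cancel₀ (siegelDeltaCharacter_ne_zero L e dV hdV dW hdW χ s p), one_mul]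

/-- **(T2, family) THE NORMALISED TRANSLATE OF A STANDARD FAMILY IS STANDARD.**  `𝒦, 𝒦′` Iwasawa data with `p⁻¹ 𝒦.K p ⊆ 𝒦′.K` for some `p ∈ P_Δ(𝔸)`, `f′` standard for
`(𝒦′, χ)` ⇒ `(f′)^♮ : s ↦ χ_s(p)⁻¹ · f′_s(· · p)` is standard for `(𝒦, χ)`: a holomorphic family of sections (★ `differentiable_siegelDeltaCharacter`, zero-free), `K`-finite
(its right `𝒦.K`-translates are the image of the right `𝒦′.K`-translates of `f′_s` under the linear map `φ ↦ χ_s(p)⁻¹·φ(· · p)`), and FLAT (`(f′)^♮_s(k) = f′_s(p⁻¹kp)`,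
independent of `s` by the flatness of `f′`). [cite: Tan1999, §1] [cite: HarrisKudlaSweet1996, (1.15)–(1.17)] [cite: MoeglinWaldspurger1995, II.1.5] -/
theorem isStandardSectionFamily_normalisedTranslate (𝒦 𝒦' : IwasawaDatum L e dV hdV dW hdW) {p : HA L e dV hdV dW hdW}
    (hp : IsSiegelDelta L e dV hdV dW hdW p) (hKK' : ∀ k : HA L e dV hdV dW hdW, k ∈ 𝒦.K → p⁻¹ * k * p ∈ 𝒦'.K)
    {χ : HeckeCharacter L} {f' : ℂ → HA L e dV hdV dW hdW → ℂ} (hstd' : IsStandardSectionFamily 𝒦' χ f') :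
    IsStandardSectionFamily 𝒦 χ (fun s h => (siegelDeltaCharacter L e dV hdV dW hdW χ s p)⁻¹ * f' s (h * p)) := by
  refine ⟨⟨fun s => isSiegelDeltaSection_normalisedTranslate (hstd'.1.1 s) _ p, fun h => ?_⟩, fun s => ?_, fun k hk s s' => ?_⟩
  · -- holomorphy in `s`
    exact ((differentiable_siegelDeltaCharacter L e dV hdV dW hdW χ p).inv (siegelDeltaCharacter_ne_zero L e dV hdV dW hdW χ · p)).mul
      (hstd'.1.2 (h * p))
  · -- `K`-finiteness
    haveI : FiniteDimensional ℂ (rightTranslateSpan 𝒦' (f' s)) := hstd'.2.1 s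
    obtain ⟨T, hT⟩ : ∃ T : (HA L e dV hdV dW hdW → ℂ) →ₗ[ℂ] (HA L e dV hdV dW hdW → ℂ),
        ∀ φ h, T φ h = (siegelDeltaCharacter L e dV hdV dW hdW χ s p)⁻¹ * φ (h * p) :=
      ⟨{ toFun := fun φ h => (siegelDeltaCharacter L e dV hdV dW hdW χ s p)⁻¹ * φ (h * p),
         map_add' := fun φ ψ => funext fun h => by simp only [Pi.add_apply]; ring,
         map_smul' := fun a φ => funext fun h => by simp only [Pi.smul_apply, smul_eq_mul, RingHom.id_apply]; ring },
        fun _ _ => rfl⟩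
    show FiniteDimensional ℂ (rightTranslateSpan 𝒦 fun h => (siegelDeltaCharacter L e dV hdV dW hdW χ s p)⁻¹ * f' s (h * p))
    have hle : rightTranslateSpan 𝒦 (fun h => (siegelDeltaCharacter L e dV hdV dW hdW χ s p)⁻¹ * f' s (h * p)) ≤ (rightTranslateSpan 𝒦' (f' s)).map T := by
      refine Submodule.span_le.2 ?_
      rintro _ ⟨k, rfl⟩
      refine ⟨fun h => f' s (h * (p⁻¹ * (k : HA L e dV hdV dW hdW) * p)), rightTranslate_mem_rightTranslateSpan 𝒦' (f' s) (hKK' k k.2), funext fun h => ?_⟩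
      rw [hT]
      show (siegelDeltaCharacter L e dV hdV dW hdW χ s p)⁻¹ * f' s (h * p * (p⁻¹ * (k : HA L e dV hdV dW hdW) * p)) =
        (siegelDeltaCharacter L e dV hdV dW hdW χ s p)⁻¹ * f' s (h * (k : HA L e dV hdV dW hdW) * p)
      congr 2
      group
    exact Submodule.finiteDimensional_of_le hle
  · -- flatness on `𝒦.K`
    show (siegelDeltaCharacter L e dV hdV dW hdW χ s p)⁻¹ * f' s (k * p) = (siegelDeltaCharacter L e dV hdV dW hdW χ s' p)⁻¹ * f' s' (k * p)
    rw [normalisedTranslate_apply_of_mem (hstd'.1.1 s) hp k, normalisedTranslate_apply_of_mem (hstd'.1.1 s') hp k, hstd'.2.2 _ (hKK' k hk) s s']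

/-- the normalised translate of a family of continuous sections is continuous in `h`. [folklore] -/
theorem continuous_normalisedTranslate {f' : ℂ → HA L e dV hdV dW hdW → ℂ} (hcont' : ∀ s, Continuous (f' s)) (c : ℂ → ℂ) (p : HA L e dV hdV dW hdW) :
    ∀ s, Continuous fun h : HA L e dV hdV dW hdW => (c s)⁻¹ * f' s (h * p) :=
  fun s => continuous_const.mul ((hcont' s).comp (continuous_id.mul continuous_const))

end Family

/-! ## §4 (T4) Socket #41's five clauses transport along the normalised translate -/

/-- **(T4) TRANSPORT OF THE CONTINUATION.**  Let `p ∈ P_Δ(𝔸)`, `f′ : ℂ → H(𝔸) → ℂ`, and let `(P, Es)` satisfy socket #41's five clauses (A1)–(A5) for the NORMALISED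
TRANSLATE `(f′)^♮_s = χ_s(p)⁻¹·f′_s(· · p)` (the adapted side).  Then `(P, Es′)` with `Es′(s, h) := χ_s(p) · Es(s, h·p⁻¹)` satisfies (A1)–(A5) for `f′`: holomorphy (`χ_s(p)` entire),
continuity, left `H(L⁺)`-invariance, the identity with `(∏_{q∈P}(s − q))·E(f′_s)` on `n∕2 < re s` (§1 (T1)), and locally uniform moderate growth with the SAME exponent `A`
(§0: `‖h p⁻¹‖^A ≤ c·‖h‖^A`, `|χ_s(p)|` bounded on the ball).  The conclusion is the socket's `∃ P Es, …` shape for `f′`.  (Valid for ANY `p ∈ H(𝔸)`; `p ∈ P_Δ(𝔸)` is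
needed only for the standardness of `(f′)^♮`, §3.) [cite: MoeglinWaldspurger1995, II.1.5, IV.1.8] [cite: BorelJacquet1979, §1.2] [cite: Tan1999, §1] -/
theorem continuation_transport (hn : 0 < n) {χ : HeckeCharacter L} (p : HA L e dV hdV dW hdW)
    (f' : ℂ → HA L e dV hdV dW hdW → ℂ) (P : Finset ℂ) (Es : ℂ → HA L e dV hdV dW hdW → ℂ)
    (hA1 : ∀ h : HA L e dV hdV dW hdW, DifferentiableOn ℂ (fun s => Es s h) {s : ℂ | 0 < s.re})
    (hA2 : ∀ s : ℂ, 0 < s.re → Continuous (Es s))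
    (hA3 : ∀ s : ℂ, 0 < s.re → ∀ (γ : ratH L e dV hdV dW hdW) (h : HA L e dV hdV dW hdW), Es s ((γ : HA L e dV hdV dW hdW) * h) = Es s h)
    (hA4 : ∀ (s : ℂ) (h : HA L e dV hdV dW hdW), (n : ℝ) / 2 < s.re →
      Es s h = (∏ q ∈ P, (s - q)) * eisensteinFamilyDelta L e dV hdV dW hdW (fun s h => (siegelDeltaCharacter L e dV hdV dW hdW χ s p)⁻¹ * f' s (h * p)) s h)
    (hA5 : ∀ z : ℂ, 0 < z.re → ∃ C A r : ℝ, 0 < r ∧ ∀ s : ℂ, dist s z < r → ∀ h : HA L e dV hdV dW hdW,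
      ‖Es s h‖ ≤ C * adelicHeightGL (n + n) L (h : GL (Fin (n + n)) (AdeleRing (𝓞 L) L)) ^ A) :
    ∃ (P' : Finset ℂ) (Es' : ℂ → HA L e dV hdV dW hdW → ℂ),
      (∀ h : HA L e dV hdV dW hdW, DifferentiableOn ℂ (fun s => Es' s h) {s : ℂ | 0 < s.re}) ∧
      (∀ s : ℂ, 0 < s.re → Continuous (Es' s)) ∧
      (∀ s : ℂ, 0 < s.re → ∀ (γ : ratH L e dV hdV dW hdW) (h : HA L e dV hdV dW hdW), Es' s ((γ : HA L e dV hdV dW hdW) * h) = Es' s h) ∧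
      (∀ (s : ℂ) (h : HA L e dV hdV dW hdW), (n : ℝ) / 2 < s.re →
        Es' s h = (∏ q ∈ P', (s - q)) * eisensteinFamilyDelta L e dV hdV dW hdW f' s h) ∧
      (∀ z : ℂ, 0 < z.re → ∃ C A r : ℝ, 0 < r ∧ ∀ s : ℂ, dist s z < r → ∀ h : HA L e dV hdV dW hdW,
        ‖Es' s h‖ ≤ C * adelicHeightGL (n + n) L (h : GL (Fin (n + n)) (AdeleRing (𝓞 L) L)) ^ A) := by
  haveI : NeZero (n + n) := ⟨by omega⟩
  refine ⟨P, fun s h => siegelDeltaCharacter L e dV hdV dW hdW χ s p * Es s (h * p⁻¹), fun h => ?_, fun s hs => ?_, fun s hs γ h => ?_, fun s h hs => ?_,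
    fun z hz => ?_⟩
  · -- (A1)
    exact (differentiable_siegelDeltaCharacter L e dV hdV dW hdW χ p).differentiableOn.mul (hA1 (h * p⁻¹))
  · -- (A2)
    exact continuous_const.mul ((hA2 s hs).comp (continuous_id.mul continuous_const))
  · -- (A3)
    show siegelDeltaCharacter L e dV hdV dW hdW χ s p * Es s ((γ : HA L e dV hdV dW hdW) * h * p⁻¹) =
      siegelDeltaCharacter L e dV hdV dW hdW χ s p * Es s (h * p⁻¹)
    rw [mul_assoc (γ : HA L e dV hdV dW hdW) h p⁻¹, hA3 s hs γ (h * p⁻¹)]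
  · -- (A4): by (T1)
    show siegelDeltaCharacter L e dV hdV dW hdW χ s p * Es s (h * p⁻¹) = (∏ q ∈ P, (s - q)) * eisensteinFamilyDelta L e dV hdV dW hdW f' s h
    rw [hA4 s (h * p⁻¹) hs, eisensteinFamilyDelta_normalisedTranslate, inv_mul_cancel_right, mul_left_comm,
      mul_inv_cancel_left₀ (siegelDeltaCharacter_ne_zero L e dV hdV dW hdW χ s p)]
  · -- (A5): two-sided height comparison + a bound of `|χ_s(p)|` on the ball
    obtain ⟨C, A, r, hr, hCA⟩ := hA5 z hz
    obtain ⟨B, hB0, hB⟩ := exists_bound_siegelDeltaCharacter L e dV hdV dW hdW χ p z r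
    obtain ⟨c, hc0, hc⟩ := exists_rpow_adelicHeightGL_mul_right_le L ((p⁻¹ : HA L e dV hdV dW hdW) : GL (Fin (n + n)) (AdeleRing (𝓞 L) L)) A
    have hC0 : 0 ≤ C := by
      have h1 := hCA z (by rwa [dist_self]) 1
      have hpos : 0 < adelicHeightGL (n + n) L ((1 : HA L e dV hdV dW hdW) : GL (Fin (n + n)) (AdeleRing (𝓞 L) L)) ^ A :=
        Real.rpow_pos_of_pos (adelicHeightGL_pos_holds (n := n + n) (K := L) _) A
      nlinarith [norm_nonneg (Es z 1)]
    refine ⟨B * C * c, A, r, hr, fun s hs h => ?_⟩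
    have hh := hCA s hs (h * p⁻¹)
    have hpow := hc (h : GL (Fin (n + n)) (AdeleRing (𝓞 L) L))
    rw [norm_mul]
    have hcoe : ((h * p⁻¹ : HA L e dV hdV dW hdW) : GL (Fin (n + n)) (AdeleRing (𝓞 L) L)) =
        (h : GL (Fin (n + n)) (AdeleRing (𝓞 L) L)) * ((p⁻¹ : HA L e dV hdV dW hdW) : GL (Fin (n + n)) (AdeleRing (𝓞 L) L)) := rfl
    rw [hcoe] at hh
    calc ‖siegelDeltaCharacter L e dV hdV dW hdW χ s p‖ * ‖Es s (h * p⁻¹)‖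
        ≤ B * (C * (c * adelicHeightGL (n + n) L (h : GL (Fin (n + n)) (AdeleRing (𝓞 L) L)) ^ A)) :=
          mul_le_mul (hB s hs) (hh.trans (mul_le_mul_of_nonneg_left hpow hC0)) (norm_nonneg _) hB0
      _ = B * C * c * adelicHeightGL (n + n) L (h : GL (Fin (n + n)) (AdeleRing (𝓞 L) L)) ^ A := by ring

end Summit.HodgeConjecture.HodgeConjecture.Cruxes.HLiu418.K2LiuSiegelEisensteinRightTranslation

end
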